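/-
Origin: expansion seat `prover-pub-hodgecm-mc-binder-2-g14-0`, handover #S3 2026-08-20T12:17Z md5 d18c88784ef2 (PKG 8baaffc48f3d → d18c88784ef2; 261 l.; σ implicit (`datumAt_of_sigmaPos/PosSwap/Neg/NegSwap`, `linSubst_kV_placePoly_datumAt`, `ins_mem_datumAt_of_letters` over `datumAtσ … σ`); proofs verbatim; NAME LIST: HodgeCM.Model.HypCensus.ins_mem_datumAt_of_letters) (`HOME/mc/pub-hodgecm-mc-binder-2/g14/s5b/HodgeCM/Model/HypCensus/InsMemDatumAt.lean`, md5 d18c88784ef2, 261 lines);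
landed by the gen-20 packager (p-g20) in gate run 51 REPLACES the earlier landed copy of `HodgeCM/Model/HypCensus/InsMemDatumAt.lean` (seat copy carried the packager Origin header of an earlier run (stripped)).
-/
/-
Origin: speedrun cell pub-hodgecm, MODEL-CONSTRUCTION sub-cell, lineage mc-binder-2 (BINDER-OWNERS rows 18/19: E binders
`hyp12` / `hyp34` of `Model.perL_picardCM_r15A`), seat prover-pub-hodgecm-mc-binder-2-g11-0 (gen 11), 2026-08-20.
Target in PKG: `HodgeCM/Model/HypCensus/InsMemDatumAt.lean` (NEW additive leaf; imports this lineage's `HypCensus/InsMemPin` (#48),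
`HypCensus/VLetterSigmaNeg` (#47), `HypCensus/OmgInsPinChoice` (#39), `HypCensus/VLetterPlaces` (#43)).  KERNEL ONLY: 0 records, nothing cited as hypothesis, 0 `def … : Prop`.
-/
import Summits.HodgeConjecture.HodgeCM.Model.HypCensus.InsMemPin
import Summits.HodgeConjecture.HodgeCM.Model.HypCensus.VLetterSigmaSwap
import Summits.HodgeConjecture.HodgeCM.Model.HypCensus.OmgInsPinChoice
import Summits.HodgeConjecture.HodgeCM.Model.HypCensus.VLetterPlaces

/-!
# Census kit (rows A12/A34), (J-x₀): `ins_mem` for the CHOSEN place data `datumAt`, per-place inputs DISCHARGED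

#48 `ins_mem_SK_of_letters` with its per-place hypothesis `hd` DISCHARGED for the chosen place data `datumAtσ V S jD (jIOf V S hW) σ`:
at `D₁₂` places #43, at `Σ₁₂` places #46/#47 (eigenvalue `1`), at the place under `ι₁` #45 + #44 through #38's identification `jIAt`
(eigenvalue `dVIota`).  What remains of `ins_mem` for rows 18/19 is the lettering hom (c) and ONE character identity (e):

* `datumAt_of_sigmaPos` / `datumAt_of_sigmaNeg` (the two `Σ₁₂` branches of #29's `datumAt`, as equations);
* `dVIota`, `dVAt`, `prod_dVAt`; **`linSubst_kV_placePoly_datumAt`** (the `hd` of #48 for `datumAt`);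
* **`ins_mem_datumAt_of_letters`**: `∀ f φ, ins … (datumAt …) m₁ m₂ f φ ∈ W₀.SK` from `lett`/`hlett` and
  `hκ : ∀ k, η(kPair k) · pinLetterChar(kVLetters (lett k)) · dVIota (lett k (cmPlace ι₁)) = archKappa k`.

Nothing here is a claim of PerL/QW8.
-/

set_option autoImplicit false

noncomputable section

open Filter Topology
open NumberField NumberField.InfinitePlace
open scoped TensorProduct Classical
open MvPolynomial
open Literature.NumberTheory.Automorphic Literature.NumberTheory.Automorphic.UnitaryGroup Literature.NumberTheory.Weil1964
open Literature.RepresentationTheory.KonnoKonno2007 Literature.RepresentationTheory.KonnoKonno2007.RealDualPair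
open Literature.NumberTheory.GelbartRogawski1991 Literature.NumberTheory.GelbartRogawski1991.UnitaryDualPair
open Literature.Analysis.SegalBargmann
open HodgeCM HodgeCM.Model HodgeCM.Adelic
open HodgeCM.PerL34.Fock HodgeCM.PerL34.Fock.PrintDict

namespace HodgeCM.Model.HypCensus

section Pin

variable {L : CMField} {ι₁ : L →+* ℂ} (V : HermSpace3 L ι₁) (S : StubTree.SeesawDatum L)
variable
  (hGR : (cmSplittingDatum (L : Type) finProdFinEquiv (frameD V) (frameD_real V) (frameD_ne V) (dW S) (dW_real S) (dW_ne S)).CompatibleSplitting)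
  (η : CMAdelic (L : Type) (frameD V) × CMAdelic (L : Type) (dW S) →* ℂˣ)
  (hη : ∀ γU ∈ CMRat (L : Type) (frameD V), ∀ γ ∈ CMRat (L : Type) (dW S), η (γU, γ) = 1)
  (hηc : Continuous fun p => ((η p : ℂˣ) : ℂ))
  (τ : L →+* ℂ) (T : GL (Fin 3) ℂ)
  (hT : formCongr (starRingEnd ℂ) T (V.Hm.map τ) = Literature.Geometry.ComplexHyperbolic.BallModel.J)
  (hV : IsAnisotropic L V.Hm)
  (hW : (∀ j, 0 < (ι₁ ((dW S) j)).re) ∨ ∀ j, (ι₁ ((dW S) j)).re < 0)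
variable (jD : InfinitePlace (L : Type) → HodgeCM.PerL34.Fock.EqVar → Fin 6)
  (jI : InfinitePlace (L : Type) → HodgeCM.PerL34.Fock.PlaneVar → Fin 6) (m₁ m₂ : InfinitePlace (L : Type) → ℤ)
variable {σ : InfinitePlace (L : Type) → Equiv.Perm (Fin 2)}

/-! ## §1 the two `Σ₁₂` branches of `datumAt` -/

/-- (Ported verbatim from the HodgeCMPerL package; no docstring in the source.) -/
theorem datumAt_of_sigmaPos (b : InfinitePlace (L : Type)) (h : cmPlacesEquiv (L : Type) b ≠ cmPlace (L : Type) ι₁)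
    (hsig : Nonempty (PosIdx (cmXW (L : Type) (frameD V) (dW S) (dW_real S) ι₁ (cmPlacesEquiv (L : Type) b))) ∧
      Nonempty (NegIdx (cmXW (L : Type) (frameD V) (dW S) (dW_real S) ι₁ (cmPlacesEquiv (L : Type) b))))
    (hQ : IsEmpty (NegIdx (cmXV (L : Type) (frameD V) (frameD_real V) ι₁ (cmPlacesEquiv (L : Type) b))))
    (hr : σ b (Classical.choice hsig.1).1 = 0) :
    datumAtσ V S jD jI σ b = PlaceDatum.sigmaPos
        ((cmEpsV (L : Type) (frameD V) (frameD_real V) ι₁ (cmPlacesEquiv (L : Type) b)).trans (@Equiv.sumEmpty _ _ hQ))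
        hQ (Classical.choice hsig.1) (Classical.choice hsig.2)
        (subsingleton_posIdx_negIdx_two hsig.1 hsig.2).1 (subsingleton_posIdx_negIdx_two hsig.1 hsig.2).2 := by
  unfold datumAtσ
  rw [dif_neg h, dif_pos hsig, dif_pos hQ, if_pos hr]

/-- (T12) the swapped positive branch: `ε_b = −1`, i.e. the positive `W`-line is line `1`. -/
theorem datumAt_of_sigmaPosSwap (b : InfinitePlace (L : Type)) (h : cmPlacesEquiv (L : Type) b ≠ cmPlace (L : Type) ι₁)
    (hsig : Nonempty (PosIdx (cmXW (L : Type) (frameD V) (dW S) (dW_real S) ι₁ (cmPlacesEquiv (L : Type) b))) ∧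
      Nonempty (NegIdx (cmXW (L : Type) (frameD V) (dW S) (dW_real S) ι₁ (cmPlacesEquiv (L : Type) b))))
    (hQ : IsEmpty (NegIdx (cmXV (L : Type) (frameD V) (frameD_real V) ι₁ (cmPlacesEquiv (L : Type) b))))
    (hr : ¬ σ b (Classical.choice hsig.1).1 = 0) :
    datumAtσ V S jD jI σ b = PlaceDatum.sigmaPosSwap
        ((cmEpsV (L : Type) (frameD V) (frameD_real V) ι₁ (cmPlacesEquiv (L : Type) b)).trans (@Equiv.sumEmpty _ _ hQ))
        hQ (Classical.choice hsig.1) (Classical.choice hsig.2)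
        (subsingleton_posIdx_negIdx_two hsig.1 hsig.2).1 (subsingleton_posIdx_negIdx_two hsig.1 hsig.2).2 := by
  unfold datumAtσ
  rw [dif_neg h, dif_pos hsig, dif_pos hQ, if_neg hr]

/-- (Ported verbatim from the HodgeCMPerL package; no docstring in the source.) -/
theorem datumAt_of_sigmaNeg (b : InfinitePlace (L : Type)) (h : cmPlacesEquiv (L : Type) b ≠ cmPlace (L : Type) ι₁)
    (hsig : Nonempty (PosIdx (cmXW (L : Type) (frameD V) (dW S) (dW_real S) ι₁ (cmPlacesEquiv (L : Type) b))) ∧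
      Nonempty (NegIdx (cmXW (L : Type) (frameD V) (dW S) (dW_real S) ι₁ (cmPlacesEquiv (L : Type) b))))
    (hQ : ¬ IsEmpty (NegIdx (cmXV (L : Type) (frameD V) (frameD_real V) ι₁ (cmPlacesEquiv (L : Type) b))))
    (hs : σ b (Classical.choice hsig.2).1 = 0) :
    datumAtσ V S jD jI σ b = PlaceDatum.sigmaNeg
        ((cmEpsV (L : Type) (frameD V) (frameD_real V) ι₁ (cmPlacesEquiv (L : Type) b)).trans
          (@Equiv.emptySum _ _ ((isEmpty_posIdx_or_negIdx_cmXV V b h).resolve_right hQ)))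
        ((isEmpty_posIdx_or_negIdx_cmXV V b h).resolve_right hQ) (Classical.choice hsig.1) (Classical.choice hsig.2)
        (subsingleton_posIdx_negIdx_two hsig.1 hsig.2).1 (subsingleton_posIdx_negIdx_two hsig.1 hsig.2).2 := by
  unfold datumAtσ
  rw [dif_neg h, dif_pos hsig, dif_neg hQ, if_pos hs]

/-- (T12) the swapped negative branch: `ε_b = −1`, i.e. the negative `W`-line is line `1`. -/
theorem datumAt_of_sigmaNegSwap (b : InfinitePlace (L : Type)) (h : cmPlacesEquiv (L : Type) b ≠ cmPlace (L : Type) ι₁)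
    (hsig : Nonempty (PosIdx (cmXW (L : Type) (frameD V) (dW S) (dW_real S) ι₁ (cmPlacesEquiv (L : Type) b))) ∧
      Nonempty (NegIdx (cmXW (L : Type) (frameD V) (dW S) (dW_real S) ι₁ (cmPlacesEquiv (L : Type) b))))
    (hQ : ¬ IsEmpty (NegIdx (cmXV (L : Type) (frameD V) (frameD_real V) ι₁ (cmPlacesEquiv (L : Type) b))))
    (hs : ¬ σ b (Classical.choice hsig.2).1 = 0) :
    datumAtσ V S jD jI σ b = PlaceDatum.sigmaNegSwap
        ((cmEpsV (L : Type) (frameD V) (frameD_real V) ι₁ (cmPlacesEquiv (L : Type) b)).trans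
          (@Equiv.emptySum _ _ ((isEmpty_posIdx_or_negIdx_cmXV V b h).resolve_right hQ)))
        ((isEmpty_posIdx_or_negIdx_cmXV V b h).resolve_right hQ) (Classical.choice hsig.1) (Classical.choice hsig.2)
        (subsingleton_posIdx_negIdx_two hsig.1 hsig.2).1 (subsingleton_posIdx_negIdx_two hsig.1 hsig.2).2 := by
  unfold datumAtσ
  rw [dif_neg h, dif_pos hsig, dif_neg hQ, if_neg hs]

/-! ## §2 the per-place scalar of a `K_V`-letter family -/

/-- the `ι₁` scalar of a `K_V`-letter at the place under `ι₁`: `det(A ∘ iotaFrameA)` (positive `W`-reading) or its `conj`. -/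
def dVIota (a : Matrix.unitaryGroup (PosIdx (cmXV (L : Type) (frameD V) (frameD_real V) ι₁ (cmPlace (L : Type) ι₁))) ℂ ×
      Matrix.unitaryGroup (NegIdx (cmXV (L : Type) (frameD V) (frameD_real V) ι₁ (cmPlace (L : Type) ι₁))) ℂ) : ℂ :=
  if ∀ j, 0 < cmXW (L : Type) (frameD V) (dW S) (dW_real S) ι₁ (cmPlace (L : Type) ι₁) j then
    (Matrix.of fun i c : Fin 2 => (a.1 : Matrix _ _ ℂ) (iotaFrameA (L : Type) (frameD V) (frameD_real V) ι₁ (frameD_sign_ι₁ V) c)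
      (iotaFrameA (L : Type) (frameD V) (frameD_real V) ι₁ (frameD_sign_ι₁ V) i)).det
  else
    (Matrix.of fun i c : Fin 2 => star ((a.1 : Matrix _ _ ℂ) (iotaFrameA (L : Type) (frameD V) (frameD_real V) ι₁ (frameD_sign_ι₁ V) c)
      (iotaFrameA (L : Type) (frameD V) (frameD_real V) ι₁ (frameD_sign_ι₁ V) i))).det

/-- the per-place scalar: `dVIota` at the place under `ι₁`, `1` elsewhere. -/
def dVAt (a : ∀ w : {v : InfinitePlace ↥(maximalRealSubfield L) // v.IsReal},
      Matrix.unitaryGroup (PosIdx (cmXV (L : Type) (frameD V) (frameD_real V) ι₁ w)) ℂ ×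
        Matrix.unitaryGroup (NegIdx (cmXV (L : Type) (frameD V) (frameD_real V) ι₁ w)) ℂ)
    (w : {v : InfinitePlace ↥(maximalRealSubfield L) // v.IsReal}) : ℂ :=
  if cmPlace (L : Type) ι₁ = w then dVIota V S (a (cmPlace (L : Type) ι₁)) else 1

/-- (Ported verbatim from the HodgeCMPerL package; no docstring in the source.) -/
theorem prod_dVAt (a : ∀ w : {v : InfinitePlace ↥(maximalRealSubfield L) // v.IsReal},
      Matrix.unitaryGroup (PosIdx (cmXV (L : Type) (frameD V) (frameD_real V) ι₁ w)) ℂ ×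
        Matrix.unitaryGroup (NegIdx (cmXV (L : Type) (frameD V) (frameD_real V) ι₁ w)) ℂ) :
    ∏ w, dVAt V S a w = dVIota V S (a (cmPlace (L : Type) ι₁)) := by
  unfold dVAt
  rw [Finset.prod_ite_eq, if_pos (Finset.mem_univ _)]

/-! ## §3 the per-place eigen-equations for `datumAt` -/

/-- **`hd` of #48 for the chosen place data**: every place polynomial of every printed pure tensor is an eigenvector of the
`K_V`-letter `((a_w.1, a_w.2), (1, 1))`, with eigenvalue `dVAt a w`. -/
theorem linSubst_kV_placePoly_datumAt
    (a : ∀ w : {v : InfinitePlace ↥(maximalRealSubfield L) // v.IsReal},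
      Matrix.unitaryGroup (PosIdx (cmXV (L : Type) (frameD V) (frameD_real V) ι₁ w)) ℂ ×
        Matrix.unitaryGroup (NegIdx (cmXV (L : Type) (frameD V) (frameD_real V) ι₁ w)) ℂ)
    (w : {v : InfinitePlace ↥(maximalRealSubfield L) // v.IsReal})
    (m : ∀ b : InfinitePlace (L : Type), ((printPlaces (InfinitePlace (L : Type))
      (kindOf (L : Type) (frameD V) (frameD_real V) (dW S) (dW_real S) ι₁ (datumAtσ V S jD (jIOf V S hW) σ))
      (lamOf (L : Type) (frameD V) (frameD_real V) (dW S) (dW_real S) ι₁ (datumAtσ V S jD (jIOf V S hW) σ))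
      (lamOf_ne_zero (L : Type) (frameD V) (frameD_real V) (dW S) (dW_real S) ι₁ (datumAtσ V S jD (jIOf V S hW) σ))
      (pinnedVacs (kindOf (L : Type) (frameD V) (frameD_real V) (dW S) (dW_real S) ι₁ (datumAtσ V S jD (jIOf V S hW) σ)) m₁ m₂)).loc b).M) :
    linSubst (star ((reindexUnitary (pairFrame (PosIdx (cmXV (L : Type) (frameD V) (frameD_real V) ι₁ w))
        (NegIdx (cmXV (L : Type) (frameD V) (frameD_real V) ι₁ w)) (PosIdx (cmXW (L : Type) (frameD V) (dW S) (dW_real S) ι₁ w))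
        (NegIdx (cmXW (L : Type) (frameD V) (dW S) (dW_real S) ι₁ w)) finProdFinEquiv (cmEpsV (L : Type) (frameD V) (frameD_real V) ι₁ w)
        (cmEpsW (L : Type) (frameD V) (dW S) (dW_real S) ι₁ w)) (dualPairι (kVLetters V S a w)) :
          Matrix.unitaryGroup (Fin 6) ℂ) : Matrix (Fin 6) (Fin 6) ℂ))
        (placePoly (L : Type) (frameD V) (frameD_real V) (dW S) (dW_real S) ι₁ (datumAtσ V S jD (jIOf V S hW) σ) m₁ m₂ m w) =
      dVAt V S a w • placePoly (L : Type) (frameD V) (frameD_real V) (dW S) (dW_real S) ι₁ (datumAtσ V S jD (jIOf V S hW) σ) m₁ m₂ m w := by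
  by_cases hk : (datumAtσ V S jD (jIOf V S hW) σ ((cmPlacesEquiv (L : Type)).symm w)).kind = .iota
  · -- the place under `ι₁`
    obtain rfl := eq_cmPlace_of_datumAt_kind V S jD (jIOf V S hW) w hk
    have hι : datumAtσ V S jD (jIOf V S hW) σ ((cmPlacesEquiv (L : Type)).symm (cmPlace (L : Type) ι₁)) =
        PlaceDatum.iota (jIAt (L : Type) (frameD V) (frameD_real V) (dW S) (dW_real S) ι₁ (frameD_sign_ι₁ V) hW) :=
      datumAt_of_eq V S jD (jIOf V S hW) _ (Equiv.apply_symm_apply _ _)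
    unfold dVAt
    rw [if_pos rfl]
    refine linSubst_placePoly_of_eq_iota (L : Type) (frameD V) (frameD_real V) (dW S) (dW_real S) ι₁ (datumAtσ V S jD (jIOf V S hW) σ) m₁ m₂
      (cmPlace (L : Type) ι₁) _ hι _ _ ?_ m
    unfold dVIota
    by_cases hR : ∀ j, 0 < cmXW (L : Type) (frameD V) (dW S) (dW_real S) ι₁ (cmPlace (L : Type) ι₁) j
    · have hj : jIAt (L : Type) (frameD V) (frameD_real V) (dW S) (dW_real S) ι₁ (frameD_sign_ι₁ V) hW =
          (pairFrame (PosIdx (cmXV (L : Type) (frameD V) (frameD_real V) ι₁ (cmPlace (L : Type) ι₁)))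
            (NegIdx (cmXV (L : Type) (frameD V) (frameD_real V) ι₁ (cmPlace (L : Type) ι₁)))
            (PosIdx (cmXW (L : Type) (frameD V) (dW S) (dW_real S) ι₁ (cmPlace (L : Type) ι₁)))
            (NegIdx (cmXW (L : Type) (frameD V) (dW S) (dW_real S) ι₁ (cmPlace (L : Type) ι₁))) finProdFinEquiv
            (cmEpsV (L : Type) (frameD V) (frameD_real V) ι₁ (cmPlace (L : Type) ι₁))
            (cmEpsW (L : Type) (frameD V) (dW S) (dW_real S) ι₁ (cmPlace (L : Type) ι₁))).symm ∘
          planeToDPIdx (iotaFrameA (L : Type) (frameD V) (frameD_real V) ι₁ (frameD_sign_ι₁ V)) (posReadingEquiv hR)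
            (iotaQ₀ (L : Type) (frameD V) (frameD_real V) ι₁ (frameD_sign_ι₁ V))
            (NegIdx (cmXW (L : Type) (frameD V) (dW S) (dW_real S) ι₁ (cmPlace (L : Type) ι₁))) := by
        unfold jIAt; rw [dif_pos hR]
      rw [if_pos hR, hj, ← rename_rename, linSubst_star_reindexUnitary_rename, linSubst_star_dualPairι_kV_rename_detZ, map_smul]
    · have hS : ∀ j, ¬0 < cmXW (L : Type) (frameD V) (dW S) (dW_real S) ι₁ (cmPlace (L : Type) ι₁) j :=
        (cmXW_cmPlace_pos_or_neg (L : Type) (frameD V) (dW S) (dW_real S) ι₁ hW).resolve_left hR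
      have hj : jIAt (L : Type) (frameD V) (frameD_real V) (dW S) (dW_real S) ι₁ (frameD_sign_ι₁ V) hW =
          (pairFrame (PosIdx (cmXV (L : Type) (frameD V) (frameD_real V) ι₁ (cmPlace (L : Type) ι₁)))
            (NegIdx (cmXV (L : Type) (frameD V) (frameD_real V) ι₁ (cmPlace (L : Type) ι₁)))
            (PosIdx (cmXW (L : Type) (frameD V) (dW S) (dW_real S) ι₁ (cmPlace (L : Type) ι₁)))
            (NegIdx (cmXW (L : Type) (frameD V) (dW S) (dW_real S) ι₁ (cmPlace (L : Type) ι₁))) finProdFinEquiv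
            (cmEpsV (L : Type) (frameD V) (frameD_real V) ι₁ (cmPlace (L : Type) ι₁))
            (cmEpsW (L : Type) (frameD V) (dW S) (dW_real S) ι₁ (cmPlace (L : Type) ι₁))).symm ∘
          planeToDPIdxS (iotaFrameA (L : Type) (frameD V) (frameD_real V) ι₁ (frameD_sign_ι₁ V)) (negReadingEquiv hS)
            (iotaQ₀ (L : Type) (frameD V) (frameD_real V) ι₁ (frameD_sign_ι₁ V))
            (PosIdx (cmXW (L : Type) (frameD V) (dW S) (dW_real S) ι₁ (cmPlace (L : Type) ι₁))) := by
        unfold jIAt; rw [dif_neg hR]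
      rw [if_neg hR, hj, ← rename_rename, linSubst_star_reindexUnitary_rename, linSubst_star_dualPairι_kV_S_rename_detZ, map_smul]
  · -- off the place under `ι₁`: eigenvalue `1`
    obtain ⟨b, rfl⟩ := (cmPlacesEquiv (L : Type)).surjective w
    have hb : cmPlacesEquiv (L : Type) b ≠ cmPlace (L : Type) ι₁ := fun h =>
      hk (by rw [Equiv.symm_apply_apply]; exact datumAt_kind_of_eq V S jD (jIOf V S hW) b h)
    unfold dVAt
    rw [if_neg (Ne.symm hb), one_smul]
    by_cases hsig : Nonempty (PosIdx (cmXW (L : Type) (frameD V) (dW S) (dW_real S) ι₁ (cmPlacesEquiv (L : Type) b))) ∧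
        Nonempty (NegIdx (cmXW (L : Type) (frameD V) (dW S) (dW_real S) ι₁ (cmPlacesEquiv (L : Type) b)))
    · by_cases hQ : IsEmpty (NegIdx (cmXV (L : Type) (frameD V) (frameD_real V) ι₁ (cmPlacesEquiv (L : Type) b)))
      · by_cases hr : σ b (Classical.choice hsig.1).1 = 0
        · exact linSubst_kV_placePoly_of_eq_sigmaPos (L : Type) (frameD V) (frameD_real V) (dW S) (dW_real S) ι₁
            (datumAtσ V S jD (jIOf V S hW) σ) m₁ m₂ b _ hQ _ _ _ _ (datumAt_of_sigmaPos V S jD (jIOf V S hW) b hb hsig hQ hr) (a _).1 (a _).2 m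
        · exact linSubst_kV_placePoly_of_eq_sigmaPosSwap (L : Type) (frameD V) (frameD_real V) (dW S) (dW_real S) ι₁
            (datumAtσ V S jD (jIOf V S hW) σ) m₁ m₂ b _ hQ _ _ _ _ (datumAt_of_sigmaPosSwap V S jD (jIOf V S hW) b hb hsig hQ hr) (a _).1 (a _).2 m
      · by_cases hs : σ b (Classical.choice hsig.2).1 = 0
        · exact linSubst_kV_placePoly_of_eq_sigmaNeg (L : Type) (frameD V) (frameD_real V) (dW S) (dW_real S) ι₁
            (datumAtσ V S jD (jIOf V S hW) σ) m₁ m₂ b _ _ _ _ _ _ (datumAt_of_sigmaNeg V S jD (jIOf V S hW) b hb hsig hQ hs) (a _).1 (a _).2 m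
        · exact linSubst_kV_placePoly_of_eq_sigmaNegSwap (L : Type) (frameD V) (frameD_real V) (dW S) (dW_real S) ι₁
            (datumAtσ V S jD (jIOf V S hW) σ) m₁ m₂ b _ _ _ _ _ _ (datumAt_of_sigmaNegSwap V S jD (jIOf V S hW) b hb hsig hQ hs) (a _).1 (a _).2 m
    · exact linSubst_placePoly_of_delta (L : Type) (frameD V) (frameD_real V) (dW S) (dW_real S) ι₁ (datumAtσ V S jD (jIOf V S hW) σ) m₁ m₂ _
        (by rw [Equiv.symm_apply_apply]; exact datumAt_kind_of_delta V S jD (jIOf V S hW) b hb hsig) _ m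

/-! ## §4 `ins_mem` for the chosen place data -/

variable
  (lett : ↥(UnitaryGroup.archIsotropy (L : Type) V.Hm τ T hT) →*
    ∀ w : {v : InfinitePlace ↥(maximalRealSubfield L) // v.IsReal},
      Matrix.unitaryGroup (PosIdx (cmXV (L : Type) (frameD V) (frameD_real V) ι₁ w)) ℂ ×
        Matrix.unitaryGroup (NegIdx (cmXV (L : Type) (frameD V) (frameD_real V) ι₁ w)) ℂ)
  (hlett : ∀ k : ↥(UnitaryGroup.archIsotropy (L : Type) V.Hm τ T hT), letterSection (L : Type) (frameD V) (frameD_real V) (frameD_ne V)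
      (dW S) (dW_real S) (dW_ne S) ι₁ (kVLetters V S (lett k)) =
    (archFrameConj (L : Type) 3 V.Hm (frameG V) (frameD V) (frame_congr V)
      (k : ↥(UnitaryGroup.arch (↥(maximalRealSubfield L)) (L : Type) (IsCMField.complexConj L) 3 V.Hm)),
     (1 : ↥(UnitaryGroup.arch (↥(maximalRealSubfield L)) (L : Type) (IsCMField.complexConj L) 2 (Matrix.diagonal (dW S))))))
  (hκ : ∀ k : ↥(UnitaryGroup.archIsotropy (L : Type) V.Hm τ T hT),
    ((η (kPair V S τ T hT k) : ℂˣ) : ℂ) * ((pinLetterChar V S hGR hW (kVLetters V S (lett k)) : Circle) : ℂ) *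
        dVIota V S (lett k (cmPlace (L : Type) ι₁)) =
      ((UnitaryGroup.archKappa (L : Type) V.Hm τ T hT k : ℂˣ) : ℂ))

include hV hlett hκ in
/-- **THE CENSUS FIELD `ins_mem` FOR THE CHOSEN PLACE DATA** (rows 18/19, junction (J-x₀)) at the W pin of record: every inserted
printed vector lies in `𝒮^κ`, from the lettering `lett`/`hlett` of `K_∞` and ONE character identity `hκ` ((V-val)). -/
theorem ins_mem_datumAt_of_letters (f : FinSB ↥(maximalRealSubfield L) (Fin 6))
    (φ : (printPlaces (InfinitePlace (L : Type))
      (kindOf (L : Type) (frameD V) (frameD_real V) (dW S) (dW_real S) ι₁ (datumAtσ V S jD (jIOf V S hW) σ))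
      (lamOf (L : Type) (frameD V) (frameD_real V) (dW S) (dW_real S) ι₁ (datumAtσ V S jD (jIOf V S hW) σ))
      (lamOf_ne_zero (L : Type) (frameD V) (frameD_real V) (dW S) (dW_real S) ι₁ (datumAtσ V S jD (jIOf V S hW) σ))
      (pinnedVacs (kindOf (L : Type) (frameD V) (frameD_real V) (dW S) (dW_real S) ι₁ (datumAtσ V S jD (jIOf V S hW) σ)) m₁ m₂)).F) :
    ins (L : Type) (frameD V) (frameD_real V) (frameD_ne V) (dW S) (dW_real S) (dW_ne S) ι₁ (datumAtσ V S jD (jIOf V S hW) σ) m₁ m₂ f φ ∈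
      (wmInputCM₂g V S hGR η hη hηc τ T hT).SK :=
  ins_mem_SK_of_letters V S hGR η hη hηc τ T hT hV hW (datumAtσ V S jD (jIOf V S hW) σ) m₁ m₂ lett hlett (fun k w => dVAt V S (lett k) w)
    (fun k w m => linSubst_kV_placePoly_datumAt V S hW jD m₁ m₂ (lett k) w m)
    (fun k => by rw [prod_dVAt]; exact hκ k) f φ

end Pin

end HodgeCM.Model.HypCensus

end
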